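import Summits.QuantumAdvantage.QuantumAdvantage.Theorems.CubicForrelationSignedExactCubicForrelationNotPrBPPStubNoTrapTransport
import Summits.QuantumAdvantage.QuantumAdvantage.Theorems.CubicForrelationSignedExactCubicForrelationNotPrBPPStubCoreReductionTransport

/-!
# Crux `CubicForrelation.SignedExactCubicForrelationNotPrBPP` (stmt-QuantumAdvantage-13932), line `dual-pingpong-frame`
# (classify-then-count cut), stub `stub_coreReduction` — lemmas for the RADICAL-FREE PAIR `(S, U) = (0, 0)`

Support file (`--supports stmt-QuantumAdvantage-13932`): bookkeeping for the proof that the classification of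
affine-free biquadratic permutations (Conjecture BQ) and the cube template statistics imply the live line's core
statement AT THE TRIVIAL PAIR `S = U = {0}` (file `…StubCoreReductionZero.lean`). Three groups of lemmas, all in the
tree vocabulary of the registered stubs (bit vectors `Fin n → Bool`, `bxor`, the inner product bit):

* affine maps: the inverse of an affine bijection is affine (`affine_symm`), the linear part of an affine map is
  additive (`linPart_additive`), affine maps are additive on three summands (`affine_bxor₃`);
* Maiorana–McFarland templates: the second difference of `g(p, q) = p·π(q) ⊕ κ(q)` in a hidden LINEAR direction
  `(u, 0)` is the component `u·(π(q) ⊕ π(q ⊕ x''))` (`template_D2_lin`), and dually for the swapped shape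
  `g(p, q) = q·σ(p) ⊕ κ(p) ⊕ c` (`template_D2_lin'`); if moreover the component `u·π` has vanishing bilinear
  differential then this second difference is base-point free (`template_D2_lin_const`, `template_D2_lin_const'`)
  — i.e. `(u, 0)` is a RADICAL direction of the cubic `g`, which is how radical-absorption at `(0,0)` forces the
  template permutation to be affine-free on both sides;
* `append_eq_zeroVec_left` / `_right`: `(u ‖ 0) = 0 → u = 0`.

References: C. Carlet, *Boolean Functions for Cryptography and Coding Theory*, CUP 2021, §2.2.2, Prop. 54
[Carlet2020]. -/

noncomputable section

set_option linter.dupNamespace false -- D-0017: single-problem summit ⇒ `QuantumAdvantage.QuantumAdvantage` by design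

namespace Summit.QuantumAdvantage.QuantumAdvantage.Theorems.SignedExactCubicForrelationNotPrBPP

open Finset
open Literature.Computability.Complexity Literature.Computability.QuantumComplexity
open Literature.Computability.QuantumComplexity.BuzetChailloux (bxor zeroVec bxor_self bxor_comm bxor_zeroVec zeroVec_bxor)
open PolarGeometry (bdot_comm bdot_bxor_left bdot_bxor_right bxor_append)
open NoTrap (bdot_unit bdot_zeroVec)
open Covariance

namespace Covariance

variable {n k m : ℕ}

/-! ### Affine maps -/

/-- **The inverse of an affine bijection is affine.** [cite: Carlet2020, §2.2.2] -/
theorem affine_symm (Λ : (Fin n → Bool) ≃ (Fin k → Bool))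
    (hΛ : ∀ x y, Λ (bxor x y) = bxor (bxor (Λ x) (Λ y)) (Λ zeroVec)) :
    ∀ x y, Λ.symm (bxor x y) = bxor (bxor (Λ.symm x) (Λ.symm y)) (Λ.symm zeroVec) := by
  intro x y
  apply Λ.injective
  rw [Equiv.apply_symm_apply, hΛ, hΛ, Equiv.apply_symm_apply, Equiv.apply_symm_apply, Equiv.apply_symm_apply]
  funext i
  show (x i ^^ y i) = ((((x i ^^ y i) ^^ Λ zeroVec i) ^^ zeroVec i) ^^ Λ zeroVec i)
  show (x i ^^ y i) = ((((x i ^^ y i) ^^ Λ zeroVec i) ^^ false) ^^ Λ zeroVec i)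
  cases x i <;> cases y i <;> cases Λ zeroVec i <;> rfl

/-- **The linear part `x ↦ Λ x ⊕ Λ 0` of an affine map is additive.** [cite: Carlet2020, §2.2.2] -/
theorem linPart_additive {Λ : (Fin n → Bool) → (Fin k → Bool)}
    (hΛ : ∀ x y, Λ (bxor x y) = bxor (bxor (Λ x) (Λ y)) (Λ zeroVec)) :
    ∀ x y, bxor (Λ (bxor x y)) (Λ zeroVec) = bxor (bxor (Λ x) (Λ zeroVec)) (bxor (Λ y) (Λ zeroVec)) := by
  intro x y
  rw [hΛ]
  funext i
  show ((((Λ x i ^^ Λ y i) ^^ Λ zeroVec i)) ^^ Λ zeroVec i) = ((Λ x i ^^ Λ zeroVec i) ^^ (Λ y i ^^ Λ zeroVec i))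
  cases Λ x i <;> cases Λ y i <;> cases Λ zeroVec i <;> rfl

/-- An affine map is additive on three summands: `Λ (a ⊕ b ⊕ c) = Λ a ⊕ Λ b ⊕ Λ c`. [cite: Carlet2020, §2.2.2] -/
theorem affine_bxor₃ {Λ : (Fin n → Bool) → (Fin k → Bool)}
    (hΛ : ∀ x y, Λ (bxor x y) = bxor (bxor (Λ x) (Λ y)) (Λ zeroVec)) (a b c : Fin n → Bool) :
    Λ (bxor (bxor a b) c) = bxor (bxor (Λ a) (Λ b)) (Λ c) := by
  rw [hΛ, hΛ]
  funext i
  show (((((Λ a i ^^ Λ b i) ^^ Λ zeroVec i)) ^^ Λ c i) ^^ Λ zeroVec i) = ((Λ a i ^^ Λ b i) ^^ Λ c i)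
  cases Λ a i <;> cases Λ b i <;> cases Λ c i <;> cases Λ zeroVec i <;> rfl

/-- An additive map is affine (with `Λ 0 = 0`). [folklore] -/
theorem affine_of_additive {Λ : (Fin n → Bool) → (Fin k → Bool)} (hΛ : ∀ x y, Λ (bxor x y) = bxor (Λ x) (Λ y)) :
    ∀ x y, Λ (bxor x y) = bxor (bxor (Λ x) (Λ y)) (Λ zeroVec) := by
  intro x y
  rw [hΛ, map_zeroVec hΛ, bxor_zeroVec]

/-! ### Bit-vector bookkeeping for `Fin.append` -/

/-- `(u ‖ v) = 0 → u = 0`. [folklore] -/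
theorem append_eq_zeroVec_left {u v : Fin m → Bool} (h : Fin.append u v = zeroVec) : u = zeroVec := by
  funext i
  have := congrFun h (Fin.castAdd m i)
  rwa [Fin.append_left] at this

/-- `(u ‖ v) = 0 → v = 0`. [folklore] -/
theorem append_eq_zeroVec_right {u v : Fin m → Bool} (h : Fin.append u v = zeroVec) : v = zeroVec := by
  funext i
  have := congrFun h (Fin.natAdd m i)
  rwa [Fin.append_right] at this

/-- The blocks of `Fin.append`. [folklore] -/
theorem castAdd_comp_append (u v : Fin m → Bool) : (fun i => Fin.append u v (Fin.castAdd m i)) = u := by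
  funext i; exact Fin.append_left u v i

/-- The blocks of `Fin.append`. [folklore] -/
theorem natAdd_comp_append (u v : Fin m → Bool) : (fun j => Fin.append u v (Fin.natAdd m j)) = v := by
  funext j; exact Fin.append_right u v j

/-! ### Second differences of Maiorana–McFarland templates in hidden linear directions -/

/-- The bilinear differential identity behind `u·B_π(v, w)`: `π(q ⊕ x) = B ⊕ π q ⊕ π x ⊕ π 0` with
`B = π(q ⊕ x) ⊕ π q ⊕ π x ⊕ π 0` read through the inner product. [folklore] -/
theorem bdot_perm_bxor (u : Fin m → Bool) (π : (Fin m → Bool) → (Fin m → Bool)) (q x : Fin m → Bool) :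
    (univ.filter fun i => u i && π (bxor q x) i).card.bodd =
      ((univ.filter fun i => u i && (π (bxor q x) i ^^ π q i ^^ π x i ^^ π zeroVec i)).card.bodd ^^
        (univ.filter fun i => u i && π q i).card.bodd ^^ (univ.filter fun i => u i && π x i).card.bodd ^^
          (univ.filter fun i => u i && π zeroVec i).card.bodd) := by
  have e : π (bxor q x) = bxor (bxor (bxor (fun i => (π (bxor q x) i ^^ π q i ^^ π x i ^^ π zeroVec i)) (π q)) (π x))
      (π zeroVec) := by
    funext i
    show π (bxor q x) i = ((((π (bxor q x) i ^^ π q i ^^ π x i ^^ π zeroVec i) ^^ π q i) ^^ π x i) ^^ π zeroVec i)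
    cases π (bxor q x) i <;> cases π q i <;> cases π x i <;> cases π zeroVec i <;> rfl
  conv_lhs => rw [e]
  rw [bdot_bxor_right, bdot_bxor_right, bdot_bxor_right]

/-- **Second difference of `g(p,q) = p·π(q) ⊕ κ(q)` in a hidden linear direction `(u, 0)`**:
`D_{(x',x'')} D_{(u,0)} g (z', z'') = u·π(z'') ⊕ u·π(z'' ⊕ x'')`. [cite: Carlet2020, Prop. 54] -/
theorem template_D2_lin {g : (Fin (m + m) → Bool) → Bool} {π : (Fin m → Bool) → (Fin m → Bool)}
    {κ : (Fin m → Bool) → Bool}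
    (hg : ∀ p q : Fin m → Bool, g (Fin.append p q) = ((univ.filter fun i => p i && π q i).card.bodd ^^ κ q))
    (u x' x'' z' z'' : Fin m → Bool) :
    (g (Fin.append z' z'') ^^ g (bxor (Fin.append z' z'') (Fin.append x' x'')) ^^
      g (bxor (Fin.append z' z'') (Fin.append u zeroVec)) ^^
        g (bxor (Fin.append z' z'') (bxor (Fin.append x' x'') (Fin.append u zeroVec)))) =
      ((univ.filter fun i => u i && π z'' i).card.bodd ^^ (univ.filter fun i => u i && π (bxor z'' x'') i).card.bodd) := by
  rw [bxor_append, bxor_append, bxor_append, bxor_append, bxor_zeroVec, bxor_zeroVec, hg, hg, hg, hg]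
  simp only [bdot_bxor_left]
  generalize (univ.filter fun i => z' i && π z'' i).card.bodd = A
  generalize (univ.filter fun i => z' i && π (bxor z'' x'') i).card.bodd = B
  generalize (univ.filter fun i => x' i && π (bxor z'' x'') i).card.bodd = C
  generalize (univ.filter fun i => u i && π z'' i).card.bodd = E
  generalize (univ.filter fun i => u i && π (bxor z'' x'') i).card.bodd = F
  generalize κ z'' = X; generalize κ (bxor z'' x'') = Y
  revert A B C E F X Y; decide

/-- **Radical direction from an affine component.** If the component `u·π` has vanishing bilinear differential
(`u·(π(v⊕w) ⊕ π v ⊕ π w ⊕ π 0) = 0` for all `v, w`), then the second difference of `g(p,q) = p·π(q) ⊕ κ(q)` in the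
directions `(x', x'')`, `(u, 0)` does not depend on the base point. [cite: Carlet2020, Prop. 54] -/
theorem template_D2_lin_const {g : (Fin (m + m) → Bool) → Bool} {π : (Fin m → Bool) → (Fin m → Bool)}
    {κ : (Fin m → Bool) → Bool}
    (hg : ∀ p q : Fin m → Bool, g (Fin.append p q) = ((univ.filter fun i => p i && π q i).card.bodd ^^ κ q))
    (u : Fin m → Bool)
    (hu : ∀ v w : Fin m → Bool, (univ.filter fun i => u i && (π (bxor v w) i ^^ π v i ^^ π w i ^^ π zeroVec i)).card.bodd = false)
    (x' x'' z' z'' : Fin m → Bool) :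
    (g (Fin.append z' z'') ^^ g (bxor (Fin.append z' z'') (Fin.append x' x'')) ^^
      g (bxor (Fin.append z' z'') (Fin.append u zeroVec)) ^^
        g (bxor (Fin.append z' z'') (bxor (Fin.append x' x'') (Fin.append u zeroVec)))) =
      ((univ.filter fun i => u i && π x'' i).card.bodd ^^ (univ.filter fun i => u i && π zeroVec i).card.bodd) := by
  rw [template_D2_lin hg, bdot_perm_bxor u π z'' x'', hu]
  generalize (univ.filter fun i => u i && π z'' i).card.bodd = A
  generalize (univ.filter fun i => u i && π x'' i).card.bodd = B
  generalize (univ.filter fun i => u i && π zeroVec i).card.bodd = C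
  revert A B C; decide

/-- **Second difference of the swapped shape `g(p,q) = q·σ(p) ⊕ κ(p) ⊕ c` in a hidden linear direction `(0, u)`**:
`D_{(x',x'')} D_{(0,u)} g (z', z'') = u·σ(z') ⊕ u·σ(z' ⊕ x')`. [cite: Carlet2020, Prop. 54] -/
theorem template_D2_lin' {g : (Fin (m + m) → Bool) → Bool} {σ : (Fin m → Bool) → (Fin m → Bool)}
    {κ : (Fin m → Bool) → Bool} {c : Bool}
    (hg : ∀ p q : Fin m → Bool, g (Fin.append p q) = ((univ.filter fun i => q i && σ p i).card.bodd ^^ κ p ^^ c))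
    (u x' x'' z' z'' : Fin m → Bool) :
    (g (Fin.append z' z'') ^^ g (bxor (Fin.append z' z'') (Fin.append x' x'')) ^^
      g (bxor (Fin.append z' z'') (Fin.append zeroVec u)) ^^
        g (bxor (Fin.append z' z'') (bxor (Fin.append x' x'') (Fin.append zeroVec u)))) =
      ((univ.filter fun i => u i && σ z' i).card.bodd ^^ (univ.filter fun i => u i && σ (bxor z' x') i).card.bodd) := by
  rw [bxor_append, bxor_append, bxor_append, bxor_append, bxor_zeroVec, bxor_zeroVec, hg, hg, hg, hg]
  simp only [bdot_bxor_left]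
  generalize (univ.filter fun i => z'' i && σ z' i).card.bodd = A
  generalize (univ.filter fun i => z'' i && σ (bxor z' x') i).card.bodd = B
  generalize (univ.filter fun i => x'' i && σ (bxor z' x') i).card.bodd = C
  generalize (univ.filter fun i => u i && σ z' i).card.bodd = E
  generalize (univ.filter fun i => u i && σ (bxor z' x') i).card.bodd = F
  generalize κ z' = X; generalize κ (bxor z' x') = Y
  clear hg
  revert A B C E F X Y c; decide

/-- **Radical direction from an affine component, swapped shape.** [cite: Carlet2020, Prop. 54] -/
theorem template_D2_lin_const' {g : (Fin (m + m) → Bool) → Bool} {σ : (Fin m → Bool) → (Fin m → Bool)}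
    {κ : (Fin m → Bool) → Bool} {c : Bool}
    (hg : ∀ p q : Fin m → Bool, g (Fin.append p q) = ((univ.filter fun i => q i && σ p i).card.bodd ^^ κ p ^^ c))
    (u : Fin m → Bool)
    (hu : ∀ v w : Fin m → Bool, (univ.filter fun i => u i && (σ (bxor v w) i ^^ σ v i ^^ σ w i ^^ σ zeroVec i)).card.bodd = false)
    (x' x'' z' z'' : Fin m → Bool) :
    (g (Fin.append z' z'') ^^ g (bxor (Fin.append z' z'') (Fin.append x' x'')) ^^
      g (bxor (Fin.append z' z'') (Fin.append zeroVec u)) ^^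
        g (bxor (Fin.append z' z'') (bxor (Fin.append x' x'') (Fin.append zeroVec u)))) =
      ((univ.filter fun i => u i && σ x' i).card.bodd ^^ (univ.filter fun i => u i && σ zeroVec i).card.bodd) := by
  rw [template_D2_lin' hg, bdot_perm_bxor u σ z' x', hu]
  generalize (univ.filter fun i => u i && σ z' i).card.bodd = A
  generalize (univ.filter fun i => u i && σ x' i).card.bodd = B
  generalize (univ.filter fun i => u i && σ zeroVec i).card.bodd = C
  revert A B C; decide

end Covariance

/-- **Radical direction from an affine component** (registered brick `coreReduction_templateRadical` of stub
`stub_coreReduction`, one-line form of `Covariance.template_D2_lin_const`): for the Maiorana–McFarland shape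
`g(p,q) = p·π(q) ⊕ κ(q)` and a component `u·π` with vanishing bilinear differential, the second difference of `g` in the
directions `(x',x'')`, `(u,0)` is base-point free. [cite: Carlet2020, Prop. 54] -/
theorem coreReduction_templateRadical : ∀ {m : ℕ} (g : (Fin (m + m) → Bool) → Bool) (π : (Fin m → Bool) → (Fin m → Bool)) (κ : (Fin m → Bool) → Bool) (u : Fin m → Bool), (∀ p q : Fin m → Bool, g (Fin.append p q) = (((Finset.univ.filter fun i => p i && π q i).card).bodd ^^ κ q)) → (∀ v w : Fin m → Bool, ((Finset.univ.filter fun i => u i && (π (bxor v w) i ^^ π v i ^^ π w i ^^ π zeroVec i)).card).bodd = false) → ∀ x' x'' z' z'' : Fin m → Bool, (g (Fin.append z' z'') ^^ g (bxor (Fin.append z' z'') (Fin.append x' x'')) ^^ g (bxor (Fin.append z' z'') (Fin.append u zeroVec)) ^^ g (bxor (Fin.append z' z'') (bxor (Fin.append x' x'') (Fin.append u zeroVec)))) = (((Finset.univ.filter fun i => u i && π x'' i).card).bodd ^^ ((Finset.univ.filter fun i => u i && π zeroVec i).card).bodd) :=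
  fun g π κ u hg hu x' x'' z' z'' => Covariance.template_D2_lin_const (g := g) (π := π) (κ := κ) hg u hu x' x'' z' z''

end Summit.QuantumAdvantage.QuantumAdvantage.Theorems.SignedExactCubicForrelationNotPrBPP

end
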